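import Summits.Ventures.CertifiedManyBodySolver.Transport.LTIPrimalHubbardChain
import HarnessLib

/-!
# Ventures/CertifiedManyBodySolver — Transport/LTIPrimalHubbardBridge.lean

Speedrun cell sr-mbsolver — LIT team (lit-1 gen-5), D-16 r36 / D-18 r72(c).
HONEST FRAMING: first certified bounds; not a superconductivity verdict; every number certified or labelled float.

Window-level bridge between the two forms of the lane-B by-value node (`Transport/LTIPrimalHubbardChain.lean`: objective = the
window's Hubbard MEAN-ENERGY observable at site `0`, per-spin densities of site `0`; `Transport/LTIPrimalHubbardChainKSDN.lean`:
FORMAT-ltisdp `hubbard_jw(U)` BOND objective on the first bond with `U` on its left site, total density of the first site). For a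
window state whose two `(|Λ'|-1)`-site marginals agree (the LTI row), every EVEN observable of the left sub-window has the same
expectation as its unit translate (`trace_toSpin_fermionEmbed_eq_of_lti`: on even elements the Jordan–Wigner reading of the CAR
isotony is the spin isotony, `toSpin_fermionEmbed_of_even` / `_of_strictMono_of_isLowerSet`, and `spinPartialTrace` is the adjoint
of `spinEmbed`); the window's mean-energy observable is `U n_{0↑}n_{0↓} + ½(-t)(B(0,1) + B(-1,0))`, `B(x,y) = Σ_σ (c†_x c_y + c†_y c_x)`
(`fermionEmbed_incl_hubbard_meanEnergyObs`, the window twin of THE MODEL's torus formula), and `B(0,1)`, `n_{0σ}` are the unit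
translates of `B(-1,0)`, `n_{-1,σ}` (`trace_meanEnergy_eq_bond_of_lti`).
[cite: KullEtAl2024, §II.B eq. (locTIn)] [cite: ArakiMoriya2003, §4.1] [cite: BratteliKishimotoRobinson1978, §3]
-/

noncomputable section

open Matrix Complex Filter Topology
open scoped ComplexOrder
open Literature.Probability.LatticeModels
open Literature.MathematicalPhysics.QuantumLattice
open Literature.MathematicalPhysics.QuantumLattice.HubbardWave0
open Literature.MathematicalPhysics.QuantumLattice.ThermodynamicLimit
open Literature.MathematicalPhysics.QuantumLattice.JordanWigner
open Literature.MathematicalPhysics.QuantumManyBody.StateRelaxation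

namespace Summit.Ventures.CertifiedManyBodySolver.Transport

/-! ### Window bookkeeping: generators under inclusions and unit translations -/

section Bookkeeping

variable {d : ℕ}

/-- `Γ(incl) n_{xσ} = n_{xσ}`. [folklore] -/
theorem fermionEmbed_incl_nAt {Λ Λ' : Finset (Site d)} (h : Λ ⊆ Λ') (x : Site d) (hx : x ∈ Λ) (σ : Fin 2) :
    fermionEmbed (PolySite.incl h) (nAt x hx σ) = nAt x (h hx) σ :=
  fermionEmbed_numberOp _ _ _

/-- `Γ(x ↦ x + v) c_{xσ} = c_{x+v,σ}` for the affine embedding with `ε = 1`. [folklore] -/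
theorem fermionEmbed_affEmb_one_cAt (v : Site d) {Λ : Finset (Site d)} (x : Site d) (hx : x ∈ Λ) (σ : Fin 2) :
    fermionEmbed (PolySite.affEmb 1 v Λ) (cAt x hx σ) = cAt (affSite 1 v x) (affSite_mem_affShiftSet 1 v hx) σ :=
  fermionEmbed_annihilation _ _ _

/-- `Γ(x ↦ x + v) n_{xσ} = n_{x+v,σ}` for the affine embedding with `ε = 1`. [folklore] -/
theorem fermionEmbed_affEmb_one_nAt (v : Site d) {Λ : Finset (Site d)} (x : Site d) (hx : x ∈ Λ) (σ : Fin 2) :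
    fermionEmbed (PolySite.affEmb 1 v Λ) (nAt x hx σ) = nAt (affSite 1 v x) (affSite_mem_affShiftSet 1 v hx) σ :=
  fermionEmbed_numberOp _ _ _

/-- `(-e₀) + e₀ = 0` for the affine map `x ↦ 1·x + e₀` of `ℤ¹`. [folklore] -/
theorem affSite_one_unitVec_neg : affSite 1 (unitVec 0) (-unitVec 0 : Site 1) = 0 := by
  funext i
  rw [Subsingleton.elim i 0, affSite_apply, Units.val_one, one_mul]
  simp [unitVec]

/-- `0 + e₀ = e₀` for the affine map `x ↦ 1·x + e₀` of `ℤ¹`. [folklore] -/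
theorem affSite_one_unitVec_zero : affSite 1 (unitVec 0) (0 : Site 1) = unitVec 0 := by
  funext i
  rw [Subsingleton.elim i 0, affSite_apply, Units.val_one, one_mul]
  simp

/-- `n_{xσ}` is even. [cite: ArakiMoriya2003, §4.1] -/
theorem parityAut_nAt {Λ : Finset (Site d)} (x : Site d) (hx : x ∈ Λ) (σ : Fin 2) :
    parityAut (nAt x hx σ) = nAt x hx σ := by
  rw [nAt, numberOp, map_mul, parityAut_creation, parityAut_annihilation, neg_mul_neg]

/-- A hopping pair `c†_x c_y + c†_y c_x` is even. [cite: ArakiMoriya2003, §4.1] -/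
theorem parityAut_hop {Λ : Finset (Site d)} (x y : Site d) (hx : x ∈ Λ) (hy : y ∈ Λ) (σ : Fin 2) :
    parityAut ((cAt x hx σ)ᴴ * cAt y hy σ + (cAt y hy σ)ᴴ * cAt x hx σ) =
      (cAt x hx σ)ᴴ * cAt y hy σ + (cAt y hy σ)ᴴ * cAt x hx σ := by
  rw [cAt, cAt, annihilation_conjTranspose, annihilation_conjTranspose, map_add, map_mul, map_mul, parityAut_creation,
    parityAut_annihilation, parityAut_creation, parityAut_annihilation, neg_mul_neg, neg_mul_neg]

/-- **The window form of the Hubbard mean-energy observable** (`d = 1`): `Γ(incl) E_Φ = U n_{0↑}n_{0↓} +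
½(-t)(B(0, e₀) + B(-e₀, 0))`, `B(x,y) = Σ_σ (c†_x c_y + c†_y c_x)` — the window twin of THE MODEL's torus formula
`fermionEmbed_toTorusEmb_hubbard_meanEnergyObs`. [cite: BratteliKishimotoRobinson1978, §3] -/
theorem fermionEmbed_incl_hubbard_meanEnergyObs (t U : ℝ) {Λ' : Finset (Site 1)}
    (h0 : thicken ({0} : Finset (Site 1)) 1 ⊆ Λ') :
    fermionEmbed (PolySite.incl h0) ((hubbardFermionInteraction 1 t U).meanEnergyObs 1) =
      (U : ℂ) • (nAt 0 (h0 (zero_mem_thicken_zero 1)) 0 * nAt 0 (h0 (zero_mem_thicken_zero 1)) 1) +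
        ((2 : ℂ)⁻¹ * -(t : ℂ)) • ∑ σ : Fin 2,
          (((cAt 0 (h0 (zero_mem_thicken_zero 1)) σ)ᴴ * cAt (unitVec 0) (h0 (unitVec_mem_thicken_one 0)) σ +
              (cAt (unitVec 0) (h0 (unitVec_mem_thicken_one 0)) σ)ᴴ * cAt 0 (h0 (zero_mem_thicken_zero 1)) σ) +
            ((cAt (-unitVec 0) (h0 (neg_unitVec_mem_thicken_one 0)) σ)ᴴ * cAt 0 (h0 (zero_mem_thicken_zero 1)) σ +
              (cAt 0 (h0 (zero_mem_thicken_zero 1)) σ)ᴴ * cAt (-unitVec 0) (h0 (neg_unitVec_mem_thicken_one 0)) σ)) := by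
  -- images of the generators under `Γ(incl ∘ incl) = Γ(incl)`
  have hc : ∀ {X : Finset (Site 1)} (hX : X ⊆ thicken ({0} : Finset (Site 1)) 1) (x : Site 1) (hx : x ∈ X) (σ : Fin 2),
      fermionEmbed ((PolySite.incl hX).trans (PolySite.incl h0)) (cAt x hx σ) = cAt x (h0 (hX hx)) σ := by
    intro X hX x hx σ
    rw [PolySite.incl_trans, fermionEmbed_incl_cAt]
  have hcd : ∀ {X : Finset (Site 1)} (hX : X ⊆ thicken ({0} : Finset (Site 1)) 1) (x : Site 1) (hx : x ∈ X) (σ : Fin 2),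
      fermionEmbed ((PolySite.incl hX).trans (PolySite.incl h0)) ((cAt x hx σ)ᴴ) = (cAt x (h0 (hX hx)) σ)ᴴ := by
    intro X hX x hx σ
    rw [fermionEmbed_conjTranspose, hc]
  have hn : ∀ {X : Finset (Site 1)} (hX : X ⊆ thicken ({0} : Finset (Site 1)) 1) (x : Site 1) (hx : x ∈ X) (σ : Fin 2),
      fermionEmbed ((PolySite.incl hX).trans (PolySite.incl h0)) (nAt x hx σ) = nAt x (h0 (hX hx)) σ := by
    intro X hX x hx σ
    rw [PolySite.incl_trans, fermionEmbed_incl_nAt]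
  rw [hubbardFermionInteraction_meanEnergyObs, fermionEmbed_add, fermionEmbed_sum, fermionEmbed_fermionEmbed,
    hubbardFermionInteraction_apply_singleton, fermionEmbed_smul, fermionEmbed_mul, hn, hn]
  congr 1
  rw [Fin.sum_univ_one, fermionEmbed_add, fermionEmbed_smul, fermionEmbed_smul, fermionEmbed_fermionEmbed,
    fermionEmbed_fermionEmbed, hubbardFermionInteraction_apply_pair, hubbardFermionInteraction_apply_pair, fermionEmbed_smul,
    fermionEmbed_smul, fermionEmbed_sum, fermionEmbed_sum, smul_smul, smul_smul, ← smul_add, ← Finset.sum_add_distrib]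
  congr 1
  refine Finset.sum_congr rfl fun σ _ => ?_
  rw [fermionEmbed_add, fermionEmbed_add, fermionEmbed_mul, fermionEmbed_mul, fermionEmbed_mul, fermionEmbed_mul,
    hc, hc, hc, hc, hcd, hcd, hcd, hcd,
    cAt_congr _ (h0 (unitVec_mem_thicken_one 0)) (zero_add (unitVec 0)) σ,
    cAt_congr _ (h0 (zero_mem_thicken_zero 1)) (neg_add_cancel (unitVec 0)) σ]

end Bookkeeping

/-! ### Even observables move inside an LTI window state -/

section Bridge

variable {Λ₀ Λ' : Finset (Site 1)}

/-- **Even observables of the left sub-window have translation-invariant expectations in an LTI window state**: if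
`tr_{Λ'∖(Λ₀+v)} ρ = tr_{Λ'∖Λ₀} ρ` then `tr(toSpin(Γ_{Λ₀+v ↪ Λ'}(τ_v a)) ρ) = tr(toSpin(Γ_{Λ₀ ↪ Λ'} a) ρ)` for even `a ∈ 𝔄_{Λ₀}`
(the Jordan–Wigner strings drop out of both isotonies; `spinPartialTrace` is the adjoint of `spinEmbed`).
[cite: KullEtAl2024, §II.B eq. (locTIn)] [cite: ArakiMoriya2003, §4.1] -/
theorem trace_toSpin_fermionEmbed_eq_of_lti (h₀ : Λ₀ ⊆ Λ') (v : Site 1) (hsh : affShiftSet 1 v Λ₀ ⊆ Λ')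
    (hlow : IsLowerSet (Set.range (PolySite.incl h₀)))
    (hmono : StrictMono ((PolySite.affEmb 1 v Λ₀).trans (PolySite.incl hsh)))
    (hconv : (Set.range ((PolySite.affEmb 1 v Λ₀).trans (PolySite.incl hsh))).OrdConnected)
    {ρ : Op (PolySite Λ') 4}
    (hLTI : spinPartialTrace ((PolySite.affEmb 1 v Λ₀).trans (PolySite.incl hsh)) ρ = spinPartialTrace (PolySite.incl h₀) ρ)
    {a : FermionOp Λ₀} (ha : parityAut a = a) :
    (toSpin (fermionEmbed ((PolySite.affEmb 1 v Λ₀).trans (PolySite.incl hsh)) a) * ρ).trace =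
      (toSpin (fermionEmbed (PolySite.incl h₀) a) * ρ).trace := by
  rw [toSpin_fermionEmbed_of_even _ hmono hconv ha,
    toSpin_fermionEmbed_of_strictMono_of_isLowerSet _ (strictMono_incl h₀) hlow,
    ← trace_mul_spinPartialTrace, ← trace_mul_spinPartialTrace, hLTI]

/-- **Mean energy = bond energy, and site-`0` densities = site-`(-1)` densities, in an LTI window state.** For a window
`Λ' ⊇ {-1, 0, 1}` with left sub-window `Λ₀ ∋ -1, 0` and the unit translation, and a window state `ρ` satisfying the LTI row:
`tr(toSpin(Γ(incl) E_Φ) ρ) = tr(toSpin(U n_{-1,↑}n_{-1,↓} - t B(-1,0)) ρ)` and `tr(toSpin(n_{0σ}) ρ) = tr(toSpin(n_{-1,σ}) ρ)`.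
[cite: KullEtAl2024, §II.B eq. (locTIn)] [cite: BratteliKishimotoRobinson1978, §3] -/
theorem trace_meanEnergy_eq_bond_of_lti (t U : ℝ) (h₀ : Λ₀ ⊆ Λ') (hsh : affShiftSet 1 (unitVec 0) Λ₀ ⊆ Λ')
    (h0 : thicken ({0} : Finset (Site 1)) 1 ⊆ Λ') (hm0 : (-unitVec 0 : Site 1) ∈ Λ₀) (hz0 : (0 : Site 1) ∈ Λ₀)
    (hlow : IsLowerSet (Set.range (PolySite.incl h₀)))
    (hmono : StrictMono ((PolySite.affEmb 1 (unitVec 0) Λ₀).trans (PolySite.incl hsh)))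
    (hconv : (Set.range ((PolySite.affEmb 1 (unitVec 0) Λ₀).trans (PolySite.incl hsh))).OrdConnected)
    {ρ : Op (PolySite Λ') 4}
    (hLTI : spinPartialTrace ((PolySite.affEmb 1 (unitVec 0) Λ₀).trans (PolySite.incl hsh)) ρ =
      spinPartialTrace (PolySite.incl h₀) ρ) :
    (toSpin (fermionEmbed (PolySite.incl h0) ((hubbardFermionInteraction 1 t U).meanEnergyObs 1)) * ρ).trace =
        (toSpin ((U : ℂ) • (nAt (-unitVec 0) (h₀ hm0) 0 * nAt (-unitVec 0) (h₀ hm0) 1) +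
          (-(t : ℂ)) • ∑ σ : Fin 2, ((cAt (-unitVec 0) (h₀ hm0) σ)ᴴ * cAt 0 (h₀ hz0) σ +
            (cAt 0 (h₀ hz0) σ)ᴴ * cAt (-unitVec 0) (h₀ hm0) σ)) * ρ).trace ∧
      ∀ σ : Fin 2, (toSpin (nAt 0 (h₀ hz0) σ) * ρ).trace = (toSpin (nAt (-unitVec 0) (h₀ hm0) σ) * ρ).trace := by
  -- abbreviations for the two embeddings
  have key := fun (a : FermionOp Λ₀) (ha : parityAut a = a) =>
    trace_toSpin_fermionEmbed_eq_of_lti h₀ (unitVec 0) hsh hlow hmono hconv hLTI ha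
  -- translates of the generators of `Λ₀` inside `Λ'`
  have hτn : ∀ σ : Fin 2, fermionEmbed ((PolySite.affEmb 1 (unitVec 0) Λ₀).trans (PolySite.incl hsh)) (nAt (-unitVec 0) hm0 σ) =
      nAt 0 (h₀ hz0) σ := by
    intro σ
    rw [← fermionEmbed_fermionEmbed, fermionEmbed_affEmb_one_nAt, fermionEmbed_incl_nAt]
    exact congrArg (fun p : PolySite Λ' => numberOp p σ) (Subtype.ext (congrArg toLex affSite_one_unitVec_neg))
  have hτc : ∀ (x : Site 1) (hx : x ∈ Λ₀) (y : Site 1) (hy : y ∈ Λ') (hxy : affSite 1 (unitVec 0) x = y) (σ : Fin 2),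
      fermionEmbed ((PolySite.affEmb 1 (unitVec 0) Λ₀).trans (PolySite.incl hsh)) (cAt x hx σ) = cAt y hy σ := by
    intro x hx y hy hxy σ
    rw [← fermionEmbed_fermionEmbed, fermionEmbed_affEmb_one_cAt, fermionEmbed_incl_cAt]
    exact cAt_congr _ hy hxy σ
  have hιn : ∀ σ : Fin 2, fermionEmbed (PolySite.incl h₀) (nAt (-unitVec 0) hm0 σ) = nAt (-unitVec 0) (h₀ hm0) σ :=
    fun σ => fermionEmbed_incl_nAt h₀ _ hm0 σ
  have hιc : ∀ (x : Site 1) (hx : x ∈ Λ₀) (σ : Fin 2), fermionEmbed (PolySite.incl h₀) (cAt x hx σ) = cAt x (h₀ hx) σ :=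
    fun x hx σ => fermionEmbed_incl_cAt h₀ x hx σ
  -- (i) densities
  have hdens : ∀ σ : Fin 2, (toSpin (nAt 0 (h₀ hz0) σ) * ρ).trace = (toSpin (nAt (-unitVec 0) (h₀ hm0) σ) * ρ).trace := by
    intro σ
    rw [← hτn σ, key _ (parityAut_nAt _ hm0 σ), hιn]
  refine ⟨?_, hdens⟩
  -- (ii) the on-site term
  have hU : (toSpin (nAt 0 (h₀ hz0) 0 * nAt 0 (h₀ hz0) 1) * ρ).trace =
      (toSpin (nAt (-unitVec 0) (h₀ hm0) 0 * nAt (-unitVec 0) (h₀ hm0) 1) * ρ).trace := by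
    have hev : parityAut (nAt (-unitVec 0) hm0 0 * nAt (-unitVec 0) hm0 1 : FermionOp Λ₀) =
        nAt (-unitVec 0) hm0 0 * nAt (-unitVec 0) hm0 1 := by
      rw [map_mul, parityAut_nAt, parityAut_nAt]
    have h := key _ hev
    rw [fermionEmbed_mul, fermionEmbed_mul, hτn, hτn, hιn, hιn] at h
    exact h
  -- (iii) the hopping terms: `B(0, e₀)` is the translate of `B(-e₀, 0)`
  have hB : ∀ σ : Fin 2,
      (toSpin ((cAt 0 (h₀ hz0) σ)ᴴ * cAt (unitVec 0) (h0 (unitVec_mem_thicken_one 0)) σ +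
          (cAt (unitVec 0) (h0 (unitVec_mem_thicken_one 0)) σ)ᴴ * cAt 0 (h₀ hz0) σ) * ρ).trace =
        (toSpin ((cAt (-unitVec 0) (h₀ hm0) σ)ᴴ * cAt 0 (h₀ hz0) σ + (cAt 0 (h₀ hz0) σ)ᴴ * cAt (-unitVec 0) (h₀ hm0) σ) *
          ρ).trace := by
    intro σ
    have h1 : fermionEmbed ((PolySite.affEmb 1 (unitVec 0) Λ₀).trans (PolySite.incl hsh))
        ((cAt (-unitVec 0) hm0 σ)ᴴ * cAt 0 hz0 σ + (cAt 0 hz0 σ)ᴴ * cAt (-unitVec 0) hm0 σ) =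
        (cAt 0 (h₀ hz0) σ)ᴴ * cAt (unitVec 0) (h0 (unitVec_mem_thicken_one 0)) σ +
          (cAt (unitVec 0) (h0 (unitVec_mem_thicken_one 0)) σ)ᴴ * cAt 0 (h₀ hz0) σ := by
      rw [fermionEmbed_add, fermionEmbed_mul, fermionEmbed_mul, fermionEmbed_conjTranspose, fermionEmbed_conjTranspose,
        hτc (-unitVec 0) hm0 0 (h₀ hz0) affSite_one_unitVec_neg,
        hτc 0 hz0 (unitVec 0) (h0 (unitVec_mem_thicken_one 0)) affSite_one_unitVec_zero]
    have h2 : fermionEmbed (PolySite.incl h₀)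
        ((cAt (-unitVec 0) hm0 σ)ᴴ * cAt 0 hz0 σ + (cAt 0 hz0 σ)ᴴ * cAt (-unitVec 0) hm0 σ) =
        (cAt (-unitVec 0) (h₀ hm0) σ)ᴴ * cAt 0 (h₀ hz0) σ + (cAt 0 (h₀ hz0) σ)ᴴ * cAt (-unitVec 0) (h₀ hm0) σ := by
      rw [fermionEmbed_add, fermionEmbed_mul, fermionEmbed_mul, fermionEmbed_conjTranspose, fermionEmbed_conjTranspose, hιc, hιc]
    have h := key _ (parityAut_hop (-unitVec 0) 0 hm0 hz0 σ)
    rw [h1, h2] at h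
    exact h
  have hS : ∑ σ : Fin 2, (toSpin ((cAt 0 (h₀ hz0) σ)ᴴ * cAt (unitVec 0) (h0 (unitVec_mem_thicken_one 0)) σ +
        (cAt (unitVec 0) (h0 (unitVec_mem_thicken_one 0)) σ)ᴴ * cAt 0 (h₀ hz0) σ) * ρ).trace =
      ∑ σ : Fin 2, (toSpin ((cAt (-unitVec 0) (h₀ hm0) σ)ᴴ * cAt 0 (h₀ hz0) σ +
        (cAt 0 (h₀ hz0) σ)ᴴ * cAt (-unitVec 0) (h₀ hm0) σ) * ρ).trace :=
    Finset.sum_congr rfl fun σ _ => hB σ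
  -- assemble: expand both sides linearly, keeping each hopping pair intact
  rw [fermionEmbed_incl_hubbard_meanEnergyObs, Finset.sum_add_distrib]
  rw [map_add, map_smul, map_smul, map_add, map_sum, map_sum, Matrix.add_mul, Matrix.smul_mul, Matrix.smul_mul,
    Matrix.add_mul, Finset.sum_mul, Finset.sum_mul, trace_add, trace_smul, trace_smul, trace_add, trace_sum, trace_sum,
    hU, hS, smul_eq_mul, smul_eq_mul]
  rw [map_add, map_smul, map_smul, map_sum, Matrix.add_mul, Matrix.smul_mul, Matrix.smul_mul, Finset.sum_mul, trace_add,
    trace_smul, trace_smul, trace_sum, smul_eq_mul, smul_eq_mul]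
  ring

end Bridge

end Summit.Ventures.CertifiedManyBodySolver.Transport
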